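import Summits.ValiantsHypothesis.ValiantsHypothesis.Theorems.AnyonJetsJetConstantElimScalarRestrictionAlgebra
import HarnessLib

/-!
# AnyonJets — crux `JetConstantElim` (stmt-ValiantsHypothesis-16737), stub `stub_integralMultiple`:
# restriction of scalars for constant-free circuits, II — the simulation pass

Route-independent (no `Theses` import, no definitions, no `sorry`). Continuing
`…ScalarRestrictionAlgebra.lean`: a fan-in-two sign-constant circuit `Γ` over `ℤ` in variables
`α ⊕ κ` is simulated, gate by gate, on `(d+1)`-tuples of coordinates (`sim_operand`, `sim_main`),
giving `exists_coordinate_circuit`: a fan-in-two sign-constant circuit `Γc` over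
`α ⊕ ((κ × Fin (d+1)) ⊕ (Fin (d+1))³)` of size `≤ (3 (d+1)³ + (d+1)) · size Γ` computing the
`0`-th coordinate `q 0` of a tuple `q` with `aeval ρK Γ.eval = Σ_l C(β l) · (aeval ρZ (q l))^K`
for every rank-`d+1` coordinate datum (`β 0 = 1`, integer multiplication table read through
`ρZ`, `κ`-variables read in `K` through `ρK`). With the padding homogenisation
(`…PaddingHomogenisation.lean`) this yields the bounded-degree bounded-height slice of
`stub_integralMultiple` (`…IntegralMultipleNumberField.lean`).

Honest framing: bookkeeping for a free slice of an open stub; VP ≠ VNP is NOT proved here.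

References: Bürgisser–Clausen–Shokrollahi (1997) §4.1; Bürgisser (2000) §4.1.
-/

noncomputable section

-- single-conjunct layout: Sub = Summit, duplicated namespace component intended
set_option linter.dupNamespace false

namespace Summit.ValiantsHypothesis.ValiantsHypothesis.Theorems.AnyonJets.JetConstantElim

open MvPolynomial Literature.Computability.AlgebraicComplexity
open Literature.Computability.AlgebraicComplexity.ArithCircuit
open scoped BigOperators

/-! ### The simulation, gate by gate -/

section Simulation

variable {α κ σ : Type*} {d : ℕ} {K : Type*} [CommRing K] {β : Fin (d + 1) → K}
  {ρK : α ⊕ κ → MvPolynomial σ K}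
  {ρZ : α ⊕ ((κ × Fin (d + 1)) ⊕ (Fin (d + 1) × Fin (d + 1) × Fin (d + 1))) → MvPolynomial σ ℤ}

/-- All `d + 1` bilinear coordinate sums of a product, one list of gates per coordinate `l ∈ Ls`
(`3 (d+1)² |Ls|` gates). [cite: Burgisser2000, §4.1] -/
theorem sc_avail_tuple_bilinear
    {gs : List (Gate ℤ (α ⊕ ((κ × Fin (d + 1)) ⊕ (Fin (d + 1) × Fin (d + 1) × Fin (d + 1)))))}
    (hg : ∀ g ∈ gs, g.fanIn ≤ 2 ∧ g.HasSignConstants)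
    {A B : Fin (d + 1) →
      MvPolynomial (α ⊕ ((κ × Fin (d + 1)) ⊕ (Fin (d + 1) × Fin (d + 1) × Fin (d + 1)))) ℤ}
    (hA : ∀ l, ∃ u : Operand ℤ (α ⊕ ((κ × Fin (d + 1)) ⊕ (Fin (d + 1) × Fin (d + 1) × Fin (d + 1)))),
      u.RefsBelow gs.length ∧ u.HasSignConstants ∧ u.eval (gateValues gs) = A l)
    (hB : ∀ l, ∃ u : Operand ℤ (α ⊕ ((κ × Fin (d + 1)) ⊕ (Fin (d + 1) × Fin (d + 1) × Fin (d + 1)))),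
      u.RefsBelow gs.length ∧ u.HasSignConstants ∧ u.eval (gateValues gs) = B l) :
    ∀ Ls : List (Fin (d + 1)),
      ∃ gs' : List (Gate ℤ (α ⊕ ((κ × Fin (d + 1)) ⊕ (Fin (d + 1) × Fin (d + 1) × Fin (d + 1))))),
      gs <+: gs' ∧ (∀ g ∈ gs', g.fanIn ≤ 2 ∧ g.HasSignConstants) ∧
      gs'.length ≤ gs.length + 3 * (d + 1) ^ 2 * Ls.length ∧
      ∀ l ∈ Ls, ∃ u : Operand ℤ (α ⊕ ((κ × Fin (d + 1)) ⊕ (Fin (d + 1) × Fin (d + 1) × Fin (d + 1)))),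
        u.RefsBelow gs'.length ∧ u.HasSignConstants ∧ u.eval (gateValues gs') =
          (((Finset.univ : Finset (Fin (d + 1) × Fin (d + 1))).toList.map fun ab =>
            A ab.1 * B ab.2 * X (Sum.inr (Sum.inr (ab.1, ab.2, l)))).sum) := by
  intro Ls
  induction Ls with
  | nil => exact ⟨gs, List.prefix_rfl, hg, by simp, fun l hl => absurd hl (by simp)⟩
  | cons l Ls ih =>
    obtain ⟨gs₁, hpre₁, hg₁, hlen₁, hav₁⟩ := ih
    obtain ⟨gs₂, hpre₂, hg₂, hlen₂, hav₂⟩ := sc_avail_bilinear hg₁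
      (G := fun a b => X (Sum.inr (Sum.inr (a, b, l))))
      (fun a => sc_avail_mono hpre₁ (hA a)) (fun b => sc_avail_mono hpre₁ (hB b))
      (fun a b => sc_avail_X gs₁ _) (Finset.univ : Finset (Fin (d + 1) × Fin (d + 1))).toList
    have hL : ((Finset.univ : Finset (Fin (d + 1) × Fin (d + 1))).toList).length = (d + 1) ^ 2 := by
      simp [Finset.length_toList, sq]
    refine ⟨gs₂, hpre₁.trans hpre₂, hg₂, ?_, fun l' hl' => ?_⟩
    · rw [hL] at hlen₂
      simp only [List.length_cons]
      nlinarith [hlen₁, hlen₂]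
    · rcases List.mem_cons.mp hl' with rfl | hmem
      · exact hav₂
      · exact sc_avail_mono hpre₂ (hav₁ l' hmem)

/-- An operand of the source circuit read at stage `j`: its coordinate tuple is available without
new gates (leaves are variables / sign constants / zero; backward references by the invariant).
[cite: Burgisser2000, §4.1] -/
theorem sim_operand (hβ0 : β 0 = 1)
    (hsc : ∀ a, ρK (Sum.inl a) = MvPolynomial.map (Int.castRingHom K) (ρZ (Sum.inl a)))
    (hK : ∀ k, ρK (Sum.inr k) = ∑ l : Fin (d + 1), C (β l) *
      MvPolynomial.map (Int.castRingHom K) (ρZ (Sum.inr (Sum.inl (k, l)))))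
    {j : ℕ} (vals : List (MvPolynomial (α ⊕ κ) ℤ)) (hvals : vals.length = j)
    {gs : List (Gate ℤ (α ⊕ ((κ × Fin (d + 1)) ⊕ (Fin (d + 1) × Fin (d + 1) × Fin (d + 1)))))}
    (hInv : ∀ i < j, ∃ q : Fin (d + 1) →
        MvPolynomial (α ⊕ ((κ × Fin (d + 1)) ⊕ (Fin (d + 1) × Fin (d + 1) × Fin (d + 1)))) ℤ,
      (∀ l, ∃ u : Operand ℤ (α ⊕ ((κ × Fin (d + 1)) ⊕ (Fin (d + 1) × Fin (d + 1) × Fin (d + 1)))),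
        u.RefsBelow gs.length ∧ u.HasSignConstants ∧ u.eval (gateValues gs) = q l) ∧
      aeval ρK (vals.getD i 0) = ∑ l : Fin (d + 1), C (β l) *
        MvPolynomial.map (Int.castRingHom K) (aeval ρZ (q l)))
    (u : Operand ℤ (α ⊕ κ)) (hu : u.HasSignConstants) :
    ∃ q : Fin (d + 1) →
        MvPolynomial (α ⊕ ((κ × Fin (d + 1)) ⊕ (Fin (d + 1) × Fin (d + 1) × Fin (d + 1)))) ℤ,
      (∀ l, ∃ u : Operand ℤ (α ⊕ ((κ × Fin (d + 1)) ⊕ (Fin (d + 1) × Fin (d + 1) × Fin (d + 1)))),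
        u.RefsBelow gs.length ∧ u.HasSignConstants ∧ u.eval (gateValues gs) = q l) ∧
      aeval ρK (u.eval vals) = ∑ l : Fin (d + 1), C (β l) *
        MvPolynomial.map (Int.castRingHom K) (aeval ρZ (q l)) := by
  cases u with
  | var i =>
    rcases i with a | k
    · refine ⟨fun l => if l = 0 then X (Sum.inl a) else 0, fun l => ?_, inv_scalarVar hβ0 hsc a⟩
      by_cases hl : l = 0
      · simpa [hl] using sc_avail_X gs (Sum.inl a)
      · simpa [hl] using sc_avail_C gs isSignConstant_zero
    · exact ⟨fun l => X (Sum.inr (Sum.inl (k, l))), fun l => sc_avail_X gs _, inv_KVar hK k⟩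
  | const c =>
    refine ⟨fun l => if l = 0 then C c else 0, fun l => ?_, inv_const hβ0 c⟩
    by_cases hl : l = 0
    · simpa [hl] using sc_avail_C gs hu
    · simpa [hl] using sc_avail_C gs isSignConstant_zero
  | gate i =>
    rcases Nat.lt_or_ge i j with hij | hji
    · exact hInv i hij
    · have hval : (Operand.gate i : Operand ℤ (α ⊕ κ)).eval vals = 0 := by
        simp [Operand.eval, List.getD_eq_getElem?_getD, List.getElem?_eq_none (hvals ▸ hji)]
      refine ⟨fun _ => 0, fun l => by simpa using sc_avail_C gs isSignConstant_zero, ?_⟩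
      rw [hval]
      simp

/-- **The simulation pass.** For every `j ≤ S = size Γ` there is a fan-in-two sign-constant gate
list of length `≤ j (3 (d+1)³ + (d+1))` over the target variables in which, for each `i < j`, a
coordinate tuple of the value of gate `i` of `Γ` is available. [cite: Burgisser2000, §4.1] -/
theorem sim_main (hβ0 : β 0 = 1)
    (hsc : ∀ a, ρK (Sum.inl a) = MvPolynomial.map (Int.castRingHom K) (ρZ (Sum.inl a)))
    (hK : ∀ k, ρK (Sum.inr k) = ∑ l : Fin (d + 1), C (β l) *
      MvPolynomial.map (Int.castRingHom K) (ρZ (Sum.inr (Sum.inl (k, l)))))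
    (hβ : ∀ a b : Fin (d + 1), C (β a) * C (β b) = ∑ l : Fin (d + 1),
      MvPolynomial.map (Int.castRingHom K) (ρZ (Sum.inr (Sum.inr (a, b, l)))) * C (β l))
    (Γ : ArithCircuit ℤ (α ⊕ κ)) (h2 : Γ.IsFanInTwo) (hs : Γ.HasSignConstants) :
    ∀ j ≤ Γ.size,
      ∃ gs : List (Gate ℤ (α ⊕ ((κ × Fin (d + 1)) ⊕ (Fin (d + 1) × Fin (d + 1) × Fin (d + 1))))),
      (∀ g ∈ gs, g.fanIn ≤ 2 ∧ g.HasSignConstants) ∧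
      gs.length ≤ j * (3 * (d + 1) ^ 3 + (d + 1)) ∧
      ∀ i < j, ∃ q : Fin (d + 1) →
          MvPolynomial (α ⊕ ((κ × Fin (d + 1)) ⊕ (Fin (d + 1) × Fin (d + 1) × Fin (d + 1)))) ℤ,
        (∀ l, ∃ u : Operand ℤ (α ⊕ ((κ × Fin (d + 1)) ⊕ (Fin (d + 1) × Fin (d + 1) × Fin (d + 1)))),
          u.RefsBelow gs.length ∧ u.HasSignConstants ∧ u.eval (gateValues gs) = q l) ∧
        aeval ρK ((gateValues (Γ.gates.take j)).getD i 0) = ∑ l : Fin (d + 1), C (β l) *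
          MvPolynomial.map (Int.castRingHom K) (aeval ρZ (q l)) := by
  have hzero : aeval ρK (0 : MvPolynomial (α ⊕ κ) ℤ) = ∑ l : Fin (d + 1), C (β l) *
      MvPolynomial.map (Int.castRingHom K) (aeval ρZ ((fun _ => (0 :
        MvPolynomial (α ⊕ ((κ × Fin (d + 1)) ⊕ (Fin (d + 1) × Fin (d + 1) × Fin (d + 1)))) ℤ)) l)) := by
    simp
  have huniv : ∀ l : Fin (d + 1), l ∈ (Finset.univ : Finset (Fin (d + 1))).toList := fun l => by simp
  have hcard : ((Finset.univ : Finset (Fin (d + 1))).toList).length = d + 1 := by simp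
  intro j
  induction j with
  | zero =>
    intro _
    exact ⟨[], by simp, by simp, fun i hi => absurd hi (Nat.not_lt_zero _)⟩
  | succ j ih =>
    intro hj1
    obtain ⟨gs, hg, hlen, hInv⟩ := ih (Nat.le_of_succ_le hj1)
    have hjlt : j < Γ.gates.length := hj1
    have hvals : (gateValues (Γ.gates.take j)).length = j := by
      rw [gateValues_length, List.length_take, Nat.min_eq_left hjlt.le]
    have hgmem : Γ.gates[j] ∈ Γ.gates := List.getElem_mem hjlt
    have hg2 : (Γ.gates[j]).fanIn ≤ 2 := h2 _ hgmem
    have hgs : (Γ.gates[j]).HasSignConstants := hs.1 _ hgmem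
    have htake : gateValues (Γ.gates.take (j + 1)) =
        gateValues (Γ.gates.take j) ++ [(Γ.gates[j]).eval (gateValues (Γ.gates.take j))] := by
      rw [List.take_succ_eq_append_getElem hjlt]
      exact gateValues_append_singleton _ _
    generalize hg_def : Γ.gates[j] = g at hgmem hg2 hgs htake
    generalize hvals_def : gateValues (Γ.gates.take j) = vals at hvals hInv htake
    -- it suffices to treat the new gate
    suffices hnew : ∃ gs' : List (Gate ℤ (α ⊕ ((κ × Fin (d + 1)) ⊕
        (Fin (d + 1) × Fin (d + 1) × Fin (d + 1))))), gs <+: gs' ∧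
        (∀ g ∈ gs', g.fanIn ≤ 2 ∧ g.HasSignConstants) ∧
        gs'.length ≤ gs.length + (3 * (d + 1) ^ 3 + (d + 1)) ∧
        ∃ q : Fin (d + 1) →
            MvPolynomial (α ⊕ ((κ × Fin (d + 1)) ⊕ (Fin (d + 1) × Fin (d + 1) × Fin (d + 1)))) ℤ,
          (∀ l, ∃ u : Operand ℤ (α ⊕ ((κ × Fin (d + 1)) ⊕ (Fin (d + 1) × Fin (d + 1) × Fin (d + 1)))),
            u.RefsBelow gs'.length ∧ u.HasSignConstants ∧ u.eval (gateValues gs') = q l) ∧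
          aeval ρK (g.eval vals) = ∑ l : Fin (d + 1), C (β l) *
            MvPolynomial.map (Int.castRingHom K) (aeval ρZ (q l)) by
      obtain ⟨gs', hpre, hg', hlen', q, hq, hI⟩ := hnew
      refine ⟨gs', hg', ?_, fun i hi => ?_⟩
      · have hmul : (j + 1) * (3 * (d + 1) ^ 3 + (d + 1)) =
            j * (3 * (d + 1) ^ 3 + (d + 1)) + (3 * (d + 1) ^ 3 + (d + 1)) := by ring
        rw [hmul]; omega
      · rw [htake]
        rcases Nat.lt_or_ge i j with hij | hji
        · obtain ⟨q', hq', hI'⟩ := hInv i hij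
          refine ⟨q', fun l => sc_avail_mono hpre (hq' l), ?_⟩
          rw [List.getD_append _ _ _ _ (by rw [hvals]; exact hij)]
          exact hI'
        · obtain rfl : i = j := by omega
          refine ⟨q, hq, ?_⟩
          rw [List.getD_append_right _ _ _ _ (by rw [hvals])]
          simpa [hvals] using hI
    have hop : ∀ (u : Operand ℤ (α ⊕ κ)), u.HasSignConstants →
        ∃ q : Fin (d + 1) →
            MvPolynomial (α ⊕ ((κ × Fin (d + 1)) ⊕ (Fin (d + 1) × Fin (d + 1) × Fin (d + 1)))) ℤ,
          (∀ l, ∃ u : Operand ℤ (α ⊕ ((κ × Fin (d + 1)) ⊕ (Fin (d + 1) × Fin (d + 1) × Fin (d + 1)))),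
            u.RefsBelow gs.length ∧ u.HasSignConstants ∧ u.eval (gateValues gs) = q l) ∧
          aeval ρK (u.eval vals) = ∑ l : Fin (d + 1), C (β l) *
            MvPolynomial.map (Int.castRingHom K) (aeval ρZ (q l)) :=
      fun u hu => sim_operand hβ0 hsc hK vals hvals hInv u hu
    cases g with
    | sum args =>
      rcases args with _ | ⟨⟨a, u⟩, _ | ⟨⟨b, v⟩, _ | ⟨c, rest⟩⟩⟩
      · refine ⟨gs, List.prefix_rfl, hg, by omega, fun _ => 0,
          fun l => by simpa using sc_avail_C gs isSignConstant_zero, ?_⟩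
        simp [Gate.eval]
      · have hau : IsSignConstant a ∧ u.HasSignConstants := hgs (a, u) (by simp)
        obtain ⟨qu, hqu, hIu⟩ := hop u hau.2
        obtain ⟨gs₁, hpre₁, hg₁, hlen₁, hav⟩ := sc_avail_tuple_sum hg hau.1 isSignConstant_zero hqu
          (fun l => by simpa using sc_avail_C gs isSignConstant_zero) (Finset.univ.toList)
        refine ⟨gs₁, hpre₁, hg₁, by rw [hcard] at hlen₁; omega, fun l => a • qu l + 0 • 0,
          fun l => hav l (huniv l), ?_⟩
        have := inv_sum hIu hzero a 0
        simpa [Gate.eval] using this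
      · have hau : IsSignConstant a ∧ u.HasSignConstants := hgs (a, u) (by simp)
        have hbv : IsSignConstant b ∧ v.HasSignConstants := hgs (b, v) (by simp)
        obtain ⟨qu, hqu, hIu⟩ := hop u hau.2
        obtain ⟨qv, hqv, hIv⟩ := hop v hbv.2
        obtain ⟨gs₁, hpre₁, hg₁, hlen₁, hav⟩ :=
          sc_avail_tuple_sum hg hau.1 hbv.1 hqu hqv (Finset.univ.toList)
        refine ⟨gs₁, hpre₁, hg₁, by rw [hcard] at hlen₁; omega,
          fun l => a • qu l + b • qv l, fun l => hav l (huniv l), ?_⟩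
        have := inv_sum hIu hIv a b
        simpa [Gate.eval] using this
      · exfalso
        simp [Gate.fanIn, Gate.args] at hg2
    | prod args =>
      rcases args with _ | ⟨u, _ | ⟨v, _ | ⟨c, rest⟩⟩⟩
      · refine ⟨gs, List.prefix_rfl, hg, by omega, fun l => if l = 0 then C 1 else 0, fun l => ?_, ?_⟩
        · by_cases hl : l = 0
          · simpa [hl] using sc_avail_C gs isSignConstant_one
          · simpa [hl] using sc_avail_C gs isSignConstant_zero
        · have := inv_const (ρK := ρK) (ρZ := ρZ) hβ0 1
          simpa [Gate.eval] using this
      · have hu : u.HasSignConstants := hgs u (by simp)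
        obtain ⟨qu, hqu, hIu⟩ := hop u hu
        refine ⟨gs, List.prefix_rfl, hg, by omega, qu, hqu, ?_⟩
        simpa [Gate.eval] using hIu
      · have hu : u.HasSignConstants := hgs u (by simp)
        have hv : v.HasSignConstants := hgs v (by simp)
        obtain ⟨qu, hqu, hIu⟩ := hop u hu
        obtain ⟨qv, hqv, hIv⟩ := hop v hv
        obtain ⟨gs₁, hpre₁, hg₁, hlen₁, hav⟩ := sc_avail_tuple_bilinear hg hqu hqv Finset.univ.toList
        refine ⟨gs₁, hpre₁, hg₁, ?_, _, fun l => hav l (huniv l), ?_⟩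
        · rw [hcard] at hlen₁
          have : 3 * (d + 1) ^ 2 * (d + 1) = 3 * (d + 1) ^ 3 := by ring
          omega
        · have := inv_prod hβ hIu hIv
          simpa [Gate.eval] using this
      · exfalso
        simp [Gate.fanIn, Gate.args] at hg2

/-- **Restriction of scalars for a constant-free circuit** (generic rank-`d+1` algebra with an
integer multiplication table): a fan-in-two sign-constant circuit `Γc` over the target variables,
of size `≤ (3 (d+1)³ + (d+1)) · size Γ`, computes the `0`-th coordinate `q 0` of a coordinate
tuple `q` of `Γ.eval`: `aeval ρK Γ.eval = Σ_l C(β l) · (aeval ρZ (q l))^K`.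
[cite: Burgisser2000, §4.1] -/
theorem exists_coordinate_circuit (hβ0 : β 0 = 1)
    (hsc : ∀ a, ρK (Sum.inl a) = MvPolynomial.map (Int.castRingHom K) (ρZ (Sum.inl a)))
    (hK : ∀ k, ρK (Sum.inr k) = ∑ l : Fin (d + 1), C (β l) *
      MvPolynomial.map (Int.castRingHom K) (ρZ (Sum.inr (Sum.inl (k, l)))))
    (hβ : ∀ a b : Fin (d + 1), C (β a) * C (β b) = ∑ l : Fin (d + 1),
      MvPolynomial.map (Int.castRingHom K) (ρZ (Sum.inr (Sum.inr (a, b, l)))) * C (β l))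
    (Γ : ArithCircuit ℤ (α ⊕ κ)) (h2 : Γ.IsFanInTwo) (hs : Γ.HasSignConstants) :
    ∃ (Γc : ArithCircuit ℤ (α ⊕ ((κ × Fin (d + 1)) ⊕ (Fin (d + 1) × Fin (d + 1) × Fin (d + 1)))))
      (q : Fin (d + 1) →
        MvPolynomial (α ⊕ ((κ × Fin (d + 1)) ⊕ (Fin (d + 1) × Fin (d + 1) × Fin (d + 1)))) ℤ),
      Γc.IsFanInTwo ∧ Γc.HasSignConstants ∧ Γc.size ≤ (3 * (d + 1) ^ 3 + (d + 1)) * Γ.size ∧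
      Γc.eval = q 0 ∧
      aeval ρK Γ.eval = ∑ l : Fin (d + 1), C (β l) *
        MvPolynomial.map (Int.castRingHom K) (aeval ρZ (q l)) := by
  obtain ⟨gs, hg, hlen, hInv⟩ := sim_main hβ0 hsc hK hβ Γ h2 hs Γ.size le_rfl
  rw [show Γ.gates.take Γ.size = Γ.gates from List.take_length] at hInv
  obtain ⟨q, hq, hI⟩ :=
    sim_operand hβ0 hsc hK (gateValues Γ.gates) (gateValues_length _) hInv Γ.output hs.2
  obtain ⟨u, hu, hus, hue⟩ := hq 0
  refine ⟨⟨gs, u⟩, q, fun g hg' => (hg g hg').1, ⟨fun g hg' => (hg g hg').2, hus⟩, ?_, hue, hI⟩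
  change gs.length ≤ _
  have hsz : Γ.size = Γ.gates.length := rfl
  rw [Nat.mul_comm] at hlen
  omega

end Simulation

end Summit.ValiantsHypothesis.ValiantsHypothesis.Theorems.AnyonJets.JetConstantElim

end
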